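import Literature.Geometry.Lorentzian.LevelCurveGeodesicCurvature
import Literature.Geometry.Lorentzian.KillingFlowIsometry
import Summits.FinalStateConjecture.FinalStateConjecture.Theorems.ZeroEnergyKerrOrBombErgoregionBombModTConvexBoundedLine
import Summits.FinalStateConjecture.FinalStateConjecture.Theorems.ZeroEnergyKerrOrBombErgoregionBombModTRiccatiLogDivergence
import Summits.FinalStateConjecture.FinalStateConjecture.Theorems.ZeroEnergyKerrOrBombErgoregionBombModTCalculusAlongGeodesic
import Summits.FinalStateConjecture.FinalStateConjecture.Theorems.ZeroEnergyKerrOrBombKerrZeroEnergyUntrappedKSEscape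
import Summits.FinalStateConjecture.FinalStateConjecture.Theorems.ZeroEnergyKerrOrBombErgoregionBombModTEscapeModFlow
import Summits.FinalStateConjecture.FinalStateConjecture.Theorems.ZeroEnergyKerrOrBombErgoregionBombModTOffWallReduction

/-!
# The zero-energy escape ENGINE (stub `stub_escapeEngine` of line `SketchIdeator4`, crux stmt-FinalStateConjecture-17838)

Route `ZeroEnergyKerrOrBomb` of the Final State Conjecture, crux `ErgoregionBombModT` (the ergoregion bomb modulo the
stationary flow), line `SketchIdeator4` (crux idea card `Cruxes/ErgoregionBombModT/Ideas/zero-energy-escape.md`).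
This file proves the registered ENGINE stub of the line:

**Zero-energy escape lemma for maximal geodesics confined modulo the flow.**  Let `𝓑` be a stationary asymptotically
flat black hole, `S` compact, and let the cage `⋃ₜ φₜ(S)` carry a *zero-energy escape certificate* `(W, F, τ, c, C)`:
`W ⊇ ⋃ₜ φₜ(S)` open; `F, τ` of class `C²` on `W`; `F` invariant and `τ` a Killing time along the integral curves of
`T` issued from `W` (`F(σ t) = F(σ 0)`, `τ(σ t) = τ(σ 0) + t`); `τ` with spacelike level sets on `W` (`dτ(k) ≠ 0`
for null `k ≠ 0`); and, for every zero-energy null vector `k` over the cage, `c·dτ(k)² ≤ Hess F(k, k)` (`c > 0`) and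
`|Hess τ(k, k)| ≤ C·dτ(k)²`.  Then NO maximal null geodesic `γ` with `γ̇ ≠ 0`, `g(γ̇, T) = 0` on its (non-empty) domain
`s` is confined to the cage (theorem `stub_escapeEngine`).  Consequently the crux holds BY VACUITY on every telescope
hole all of whose cages carry a certificate: `ergoregionBombModT_of_zeroEnergyEscapeCertificate` — the REDUCTION
`ErgoregionBombModT ⇐ ZeroEnergyEscapeCertificate` (hypothesis = the registered kernel stub
`stub_zeroEnergyEscapeCertificate` verbatim, conclusion = the body of the route decl verbatim, so that the type δ-unfolds
to `Theses.ZeroEnergyKerrOrBomb.ErgoregionBombModT` and the file stays free of the `Theses` import).  The kernel — the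
certificate half of the Alexakis–Ionescu–Klainerman picture, certified on Kerr by Carter's turning-point sign
(`Kerr.hessAt_radius_neg_of_ksEnergy_eq_zero`) — is open in general and is NOT claimed here.

Assembly from the landed bricks of the line:
* `φ := F ∘ γ` is bounded (invariance of `F`, compactness of `S`; brick G12 `stub_calculusAlongGeodesic`, p154804),
  `φ' = dF(γ̇) =: u` and `u' = Hess F(γ̇, γ̇) =: w` (O'Neill 1983, Ch. 3, Lemma 3.49 along the geodesic; G12), likewise
  `ρ := dτ(γ̇)` has `ρ' = Hess τ(γ̇, γ̇) =: v`; the certificate gives `w ≥ c ρ²`, `|v| ≤ C ρ²`, and `ρ ≠ 0` (`γ̇` is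
  null and non-zero), hence `ρ` has one sign on the interval `s` (intermediate value theorem);
* a FINITE end of `s` is impossible: maximality makes `|ρ|` unbounded there (brick G3 `stub_escapeModFlow`, the
  escape lemma modulo the flow, p155599), and then the Riccati bound forces `|ρ| ≥ 1/(C(b−t))`, `w ≥ c/(C²(b−t)²)`
  and `φ → +∞` (brick R23 `stub_riccatiLogDivergence`, p154806) — against boundedness; the lower end is the time
  reversal `t ↦ −t` of the upper end, performed on the real functions only;
* two INFINITE ends (`s = ℝ`) are impossible by convexity: `φ'' = w > 0` on `ℝ` with `φ` bounded (brick R1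
  `stub_convexBoundedLine`, p154600).

References: B. O'Neill, *Semi-Riemannian geometry* (1983), Ch. 3 Lemma 3.49, Ch. 5 Lemma 8; G. P. Paternain,
M. Salo, G. Uhlmann, *Geometric inverse problems* (2023), Prop. 3.3.1 (non-trapping ⇔ escape function, the Riemannian
prototype; tree `Literature/Geometry/Riemannian/NonTrappingEscapeFunction.lean`); A. D. Ionescu, S. Klainerman,
Surveys Diff. Geom. 20 (2015) §4; crux workfiles `Cruxes/ErgoregionBombModT/Ideas/zero-energy-escape.md`,
`Cruxes/ErgoregionBombModT/Lines/SketchIdeator4.lean`.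
-/
noncomputable section

open Bundle Set Filter Function
open scoped Manifold Topology

set_option linter.dupNamespace false

namespace Summit.FinalStateConjecture.FinalStateConjecture.Theorems.ErgoregionBombModT

open Literature.Geometry.Lorentzian

/-! ### Real-variable glue -/

/-- An open set of reals containing `t` contains `t + δ` for some `δ > 0`. [folklore] -/
private theorem exists_add_mem_of_isOpen {s : Set ℝ} (hso : IsOpen s) {t : ℝ} (ht : t ∈ s) :
    ∃ δ > 0, t + δ ∈ s := by
  obtain ⟨δ, hδ, hball⟩ := Metric.isOpen_iff.1 hso t ht
  refine ⟨δ / 2, by positivity, hball ?_⟩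
  rw [Metric.mem_ball, Real.dist_eq]
  rw [show t + δ / 2 - t = δ / 2 by ring, abs_of_pos (by positivity)]
  linarith

/-- In an open order-connected bounded-above set of reals, the segment from a point `t₀` of the set
to its supremum lies in the set, the supremum excluded. [folklore] -/
private theorem Ico_csSup_subset {s : Set ℝ} (hsc : s.OrdConnected) {t₀ : ℝ} (ht₀ : t₀ ∈ s) :
    Ico t₀ (sSup s) ⊆ s := by
  intro t ht
  obtain ⟨t', ht's, htt'⟩ := exists_lt_of_lt_csSup ⟨t₀, ht₀⟩ ht.2
  exact hsc.out ht₀ ht's ⟨ht.1, htt'.le⟩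

/-- A point of an open bounded-above set of reals lies strictly below its supremum. [folklore] -/
private theorem lt_csSup_of_mem {s : Set ℝ} (hso : IsOpen s) (hab : BddAbove s) {t : ℝ} (ht : t ∈ s) :
    t < sSup s := by
  obtain ⟨δ, hδ, hδs⟩ := exists_add_mem_of_isOpen hso ht
  have := le_csSup hab hδs
  linarith

/-- **The finite-upper-end contradiction** (species (b) of the engine): on an open interval `s`, bounded
above, real functions with `φ' = u`, `u' = w ≥ c ρ²`, `ρ' = v`, `|v| ≤ C ρ²`, `ρ > 0`, `ρ` unbounded on
every terminal segment and `φ` bounded cannot coexist (registered brick R23 on `[t₀, sup s)`). -/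
private theorem false_of_bddAbove_end {s : Set ℝ} (hso : IsOpen s) (hsc : s.OrdConnected) {t₀ : ℝ}
    (ht₀ : t₀ ∈ s) (hab : BddAbove s) {φ u w ρ v : ℝ → ℝ} {c C M : ℝ} (hc : 0 < c) (hC : 0 < C)
    (hφ' : ∀ t ∈ s, HasDerivAt φ (u t) t) (hu' : ∀ t ∈ s, HasDerivAt u (w t) t)
    (hρ' : ∀ t ∈ s, HasDerivAt ρ (v t) t) (hρpos : ∀ t ∈ s, 0 < ρ t)
    (hw : ∀ t ∈ s, c * ρ t ^ 2 ≤ w t) (hv : ∀ t ∈ s, |v t| ≤ C * ρ t ^ 2)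
    (hunb : ∀ B : ℝ, ∃ t ∈ s, t₀ ≤ t ∧ B < ρ t) (hM : ∀ t ∈ s, |φ t| ≤ M) : False := by
  set b := sSup s with hb
  have hsub : Ico t₀ b ⊆ s := Ico_csSup_subset hsc ht₀
  have ht₀b : t₀ < b := lt_csSup_of_mem hso hab ht₀
  have hunb' : ∀ n : ℕ, ∃ t ∈ Ico t₀ b, (n : ℝ) ≤ ρ t := by
    intro n
    obtain ⟨t, hts, ht₀t, hnt⟩ := hunb n
    exact ⟨t, ⟨ht₀t, lt_csSup_of_mem hso hab hts⟩, hnt.le⟩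
  obtain ⟨t, ht, hMt⟩ := stub_riccatiLogDivergence φ u w ρ v t₀ b c C ht₀b hc hC
    (fun t ht ↦ hφ' t (hsub ht)) (fun t ht ↦ hu' t (hsub ht)) (fun t ht ↦ hρ' t (hsub ht))
    (fun t ht ↦ hρpos t (hsub ht)) (fun t ht ↦ hw t (hsub ht)) (fun t ht ↦ hv t (hsub ht)) hunb' M
  have h1 := hM t (hsub ht)
  have h2 := le_abs_self (φ t)
  linarith

/-- **The finite-lower-end contradiction**: the time-reversed form of `false_of_bddAbove_end` (reflect
`t ↦ -t`: `φ̂ = φ ∘ neg`, `û = -u ∘ neg`, `ŵ = w ∘ neg`, `ρ̂ = ρ ∘ neg`, `v̂ = -v ∘ neg`). -/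
private theorem false_of_bddBelow_end {s : Set ℝ} (hso : IsOpen s) (hsc : s.OrdConnected) {t₀ : ℝ}
    (ht₀ : t₀ ∈ s) (hbb : BddBelow s) {φ u w ρ v : ℝ → ℝ} {c C M : ℝ} (hc : 0 < c) (hC : 0 < C)
    (hφ' : ∀ t ∈ s, HasDerivAt φ (u t) t) (hu' : ∀ t ∈ s, HasDerivAt u (w t) t)
    (hρ' : ∀ t ∈ s, HasDerivAt ρ (v t) t) (hρpos : ∀ t ∈ s, 0 < ρ t)
    (hw : ∀ t ∈ s, c * ρ t ^ 2 ≤ w t) (hv : ∀ t ∈ s, |v t| ≤ C * ρ t ^ 2)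
    (hunb : ∀ B : ℝ, ∃ t ∈ s, t ≤ t₀ ∧ B < ρ t) (hM : ∀ t ∈ s, |φ t| ≤ M) : False := by
  -- the reflected set
  set s' : Set ℝ := (fun t ↦ -t) ⁻¹' s with hs'
  have hso' : IsOpen s' := hso.preimage continuous_neg
  have hsc' : s'.OrdConnected := by
    refine Set.ordConnected_iff.2 fun a ha c' hc' _ t ht ↦ ?_
    show -t ∈ s
    exact hsc.out hc' ha ⟨neg_le_neg ht.2, neg_le_neg ht.1⟩
  have ht₀' : -t₀ ∈ s' := by show -(-t₀) ∈ s; rw [neg_neg]; exact ht₀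
  have hab' : BddAbove s' := by
    obtain ⟨a, ha⟩ := hbb
    refine ⟨-a, fun t ht ↦ ?_⟩
    have := ha ht
    linarith
  refine false_of_bddAbove_end hso' hsc' ht₀' hab' (φ := fun t ↦ φ (-t)) (u := fun t ↦ -u (-t))
    (w := fun t ↦ w (-t)) (ρ := fun t ↦ ρ (-t)) (v := fun t ↦ -v (-t)) (c := c) (C := C) (M := M) hc hC
    ?_ ?_ ?_ ?_ ?_ ?_ ?_ ?_
  · intro t ht
    exact ((hφ' (-t) ht).comp t (hasDerivAt_neg t)).congr_deriv (by ring)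
  · intro t ht
    exact (((hu' (-t) ht).comp t (hasDerivAt_neg t)).neg).congr_deriv (by ring)
  · intro t ht
    exact ((hρ' (-t) ht).comp t (hasDerivAt_neg t)).congr_deriv (by ring)
  · exact fun t ht ↦ hρpos (-t) ht
  · exact fun t ht ↦ hw (-t) ht
  · intro t ht
    simpa [abs_neg] using hv (-t) ht
  · intro B
    obtain ⟨t, hts, htt₀, hBt⟩ := hunb B
    exact ⟨-t, by show -(-t) ∈ s; rw [neg_neg]; exact hts, neg_le_neg htt₀, by simpa using hBt⟩
  · exact fun t ht ↦ hM (-t) ht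

/-- **Constant sign of a non-vanishing function with a derivative on an interval** (intermediate
value theorem): there is `e = ±1` with `e ρ > 0` on `s`. [folklore] -/
private theorem exists_sign_of_ne_zero {s : Set ℝ} (hsc : s.OrdConnected) {ρ v : ℝ → ℝ}
    (hρ' : ∀ t ∈ s, HasDerivAt ρ (v t) t) (hρ0 : ∀ t ∈ s, ρ t ≠ 0) {t₀ : ℝ} (ht₀ : t₀ ∈ s) :
    ∃ e : ℝ, (e = 1 ∨ e = -1) ∧ ∀ t ∈ s, 0 < e * ρ t := by
  have hcont : ContinuousOn ρ s := fun t ht ↦ (hρ' t ht).continuousAt.continuousWithinAt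
  have hpre : IsPreconnected s := hsc.isPreconnected
  rcases lt_or_gt_of_ne (hρ0 t₀ ht₀) with hneg | hpos
  · refine ⟨-1, Or.inr rfl, fun t ht ↦ ?_⟩
    rcases lt_or_gt_of_ne (hρ0 t ht) with h | h
    · linarith
    · exfalso
      obtain ⟨x, hxs, hx0⟩ := hpre.intermediate_value ht₀ ht hcont ⟨hneg.le, h.le⟩
      exact hρ0 x hxs hx0
  · refine ⟨1, Or.inl rfl, fun t ht ↦ ?_⟩
    rcases lt_or_gt_of_ne (hρ0 t ht) with h | h
    · exfalso
      obtain ⟨x, hxs, hx0⟩ := hpre.intermediate_value ht ht₀ hcont ⟨h.le, hpos.le⟩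
      exact hρ0 x hxs hx0
    · linarith

/-! ### The engine -/

/-- **The zero-energy escape engine** (registered stub `stub_escapeEngine` of line `SketchIdeator4`): on a stationary
asymptotically flat black hole, if the cage `⋃ₜ φₜ(S)` of a compact `S` carries a zero-energy escape certificate
`(W, F, τ, c, C)`, then no maximal null geodesic with `γ̇ ≠ 0`, `g(γ̇, T) = 0` is confined to the cage.  Assembly:
`φ := F ∘ γ` is bounded (G12, invariance of `F`), `φ' = dF(γ̇) =: u`, `u' = Hess F(γ̇, γ̇) ≥ c ρ²` and
`ρ := dτ(γ̇)`, `ρ' = Hess τ(γ̇, γ̇)`, `|ρ'| ≤ C ρ²` (G12, certificate), `ρ ≠ 0` (spacelike levels, `γ̇ ≠ 0` null) hence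
of one sign; a finite end of the domain is impossible by maximality (G3: `ρ` unbounded there) and R23, two infinite
ends by R1. -/
theorem stub_escapeEngine : ∀ (𝓑 : StationaryAFBlackHole.{0}) [𝓑.metric.HasLeviCivita] (S W : Set 𝓑.carrier) (F τ : 𝓑.carrier → ℝ) (c C : ℝ), IsCompact S → IsOpen W → stationaryOrbit 𝓑.killing S ⊆ W → 0 < c → ContMDiffOn (𝓡 4) 𝓘(ℝ, ℝ) 2 F W → ContMDiffOn (𝓡 4) 𝓘(ℝ, ℝ) 2 τ W → (∀ σ : ℝ → 𝓑.carrier, IsMIntegralCurve σ 𝓑.killing → σ 0 ∈ W → ∀ t, F (σ t) = F (σ 0) ∧ τ (σ t) = τ (σ 0) + t) → (∀ x ∈ W, ∀ k : TangentSpace (𝓡 4) x, 𝓑.metric.val x k k = 0 → k ≠ 0 → mvfderiv (𝓡 4) τ x k ≠ 0) → (∀ x ∈ stationaryOrbit 𝓑.killing S, ∀ k : TangentSpace (𝓡 4) x, 𝓑.metric.val x k k = 0 → 𝓑.metric.val x k (𝓑.killing x) = 0 → c * (mvfderiv (𝓡 4) τ x k) ^ 2 ≤ 𝓑.metric.toPseudoRiemannianMetric.hessian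 F x k k ∧ |𝓑.metric.toPseudoRiemannianMetric.hessian τ x k k| ≤ C * (mvfderiv (𝓡 4) τ x k) ^ 2) → ∀ (γ : ℝ → 𝓑.carrier) (s : Set ℝ), IsMaximalGeodesicOn 𝓑.metric.toPseudoRiemannianMetric.leviCivita γ s → s.Nonempty → (∀ t ∈ s, 𝓑.metric.val (γ t) (velocity (𝓡 4) γ t) (velocity (𝓡 4) γ t) = 0 ∧ velocity (𝓡 4) γ t ≠ 0 ∧ 𝓑.metric.val (γ t) (velocity (𝓡 4) γ t) (𝓑.killing (γ t)) = 0) → (∀ t ∈ s, γ t ∈ stationaryOrbit 𝓑.killing S) → False := by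
  intro 𝓑 _ S W F τ c C hS hW hSW hc hF hτ hinv hnd hH γ s hγ hs hz hin
  -- bookkeeping
  have hSW' : S ⊆ W :=
    (subset_stationaryOrbit 𝓑.isStationaryKilling.isCompleteVectorField S).trans hSW
  have hτ1 : ContMDiffOn (𝓡 4) 𝓘(ℝ, ℝ) 1 τ W := hτ.of_le (by norm_num)
  have hFinv : ∀ σ : ℝ → 𝓑.carrier, IsMIntegralCurve σ 𝓑.killing → σ 0 ∈ S → ∀ t, F (σ t) = F (σ 0) :=
    fun σ hσ h0 t ↦ (hinv σ hσ (hSW' h0) t).1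
  have hτeq : ∀ σ : ℝ → 𝓑.carrier, IsMIntegralCurve σ 𝓑.killing → σ 0 ∈ W → ∀ t, τ (σ t) = τ (σ 0) + t :=
    fun σ hσ h0 t ↦ (hinv σ hσ h0 t).2
  have hγW : ∀ t ∈ s, γ t ∈ W := fun t ht ↦ hSW (hin t ht)
  have hso : IsOpen s := hγ.1
  have hsc : s.OrdConnected := hγ.2.1
  have hgeo : IsGeodesicOn 𝓑.metric.toPseudoRiemannianMetric.leviCivita γ s := hγ.2.2.1
  obtain ⟨t₀, ht₀⟩ := hs
  -- calculus along `γ` (G12) for `F` and `τ`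
  obtain ⟨hderF, hbddF⟩ := stub_calculusAlongGeodesic 𝓑 W F hW hF
  obtain ⟨hderτ, -⟩ := stub_calculusAlongGeodesic 𝓑 W τ hW hτ
  -- the five scalar functions
  set φ : ℝ → ℝ := fun t ↦ F (γ t) with hφ
  set u : ℝ → ℝ := fun t ↦ mvfderiv (𝓡 4) F (γ t) (velocity (𝓡 4) γ t) with hu
  set w : ℝ → ℝ := fun t ↦
    𝓑.metric.toPseudoRiemannianMetric.hessian F (γ t) (velocity (𝓡 4) γ t) (velocity (𝓡 4) γ t) with hw
  set ρ : ℝ → ℝ := fun t ↦ mvfderiv (𝓡 4) τ (γ t) (velocity (𝓡 4) γ t) with hρ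
  set v : ℝ → ℝ := fun t ↦
    𝓑.metric.toPseudoRiemannianMetric.hessian τ (γ t) (velocity (𝓡 4) γ t) (velocity (𝓡 4) γ t) with hv
  have hφ' : ∀ t ∈ s, HasDerivAt φ (u t) t := fun t ht ↦ (hderF γ s hgeo hγW t ht).1
  have hu' : ∀ t ∈ s, HasDerivAt u (w t) t := fun t ht ↦ (hderF γ s hgeo hγW t ht).2
  have hρ' : ∀ t ∈ s, HasDerivAt ρ (v t) t := fun t ht ↦ (hderτ γ s hgeo hγW t ht).2
  -- the certificate along `γ`
  set C' : ℝ := max C 1 with hC'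
  have hC'pos : 0 < C' := lt_max_of_lt_right one_pos
  have hwρ : ∀ t ∈ s, c * ρ t ^ 2 ≤ w t := fun t ht ↦
    (hH (γ t) (hin t ht) (velocity (𝓡 4) γ t) (hz t ht).1 (hz t ht).2.2).1
  have hvρ : ∀ t ∈ s, |v t| ≤ C' * ρ t ^ 2 := fun t ht ↦
    ((hH (γ t) (hin t ht) (velocity (𝓡 4) γ t) (hz t ht).1 (hz t ht).2.2).2).trans
      (mul_le_mul_of_nonneg_right (le_max_left C 1) (sq_nonneg _))
  have hρ0 : ∀ t ∈ s, ρ t ≠ 0 := fun t ht ↦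
    hnd (γ t) (hγW t ht) (velocity (𝓡 4) γ t) (hz t ht).1 (hz t ht).2.1
  have hwpos : ∀ t ∈ s, 0 < w t := fun t ht ↦
    lt_of_lt_of_le (mul_pos hc (sq_pos_iff.mpr (hρ0 t ht))) (hwρ t ht)
  -- boundedness of `φ`
  obtain ⟨M, hM⟩ := hbddF S hS hSW' hFinv
  have hMφ : ∀ t ∈ s, |φ t| ≤ M := fun t ht ↦ hM (γ t) (hin t ht)
  -- one sign for `ρ`
  obtain ⟨e, he, hepos⟩ := exists_sign_of_ne_zero hsc hρ' hρ0 ht₀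
  have he2 : e ^ 2 = 1 := by rcases he with rfl | rfl <;> norm_num
  have heabs : ∀ t ∈ s, |ρ t| = e * ρ t := fun t ht ↦ by
    rcases he with rfl | rfl
    · rw [one_mul]; exact abs_of_pos (by simpa using hepos t ht)
    · have h := hepos t ht
      rw [neg_one_mul] at h ⊢
      exact abs_of_neg (by linarith)
  -- escape modulo the flow (G3)
  have hesc : ∀ B : ℝ, ((∀ t ∈ s, t₀ ≤ t → |ρ t| ≤ B) → ¬ BddAbove s) ∧
      ((∀ t ∈ s, t ≤ t₀ → |ρ t| ≤ B) → ¬ BddBelow s) := fun B ↦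
    stub_escapeModFlow 𝓑 S W τ B hS hW hSW hτ1 hτeq hnd γ s hγ (fun t ht ↦ (hz t ht).1) hin t₀ ht₀
  -- the signed frequency
  have hρ'e : ∀ t ∈ s, HasDerivAt (fun t ↦ e * ρ t) (e * v t) t := fun t ht ↦ (hρ' t ht).const_mul e
  have hwe : ∀ t ∈ s, c * (e * ρ t) ^ 2 ≤ w t := fun t ht ↦ by
    rw [mul_pow, he2, one_mul]; exact hwρ t ht
  have hve : ∀ t ∈ s, |e * v t| ≤ C' * (e * ρ t) ^ 2 := fun t ht ↦ by
    rw [mul_pow, he2, one_mul, abs_mul]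
    rcases he with rfl | rfl <;> simpa using hvρ t ht
  -- case analysis on the ends of `s`
  by_cases hab : BddAbove s
  · refine false_of_bddAbove_end hso hsc ht₀ hab hc hC'pos hφ' hu' hρ'e hepos hwe hve ?_ hMφ
    intro B
    by_contra hcon
    push Not at hcon
    refine (hesc B).1 (fun t ht ht₀t ↦ ?_) hab
    rw [heabs t ht]; exact hcon t ht ht₀t
  by_cases hbb : BddBelow s
  · refine false_of_bddBelow_end hso hsc ht₀ hbb hc hC'pos hφ' hu' hρ'e hepos hwe hve ?_ hMφ
    intro B
    by_contra hcon
    push Not at hcon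
    refine (hesc B).2 (fun t ht htt₀ ↦ ?_) hbb
    rw [heabs t ht]; exact hcon t ht htt₀
  -- both ends infinite: `s = ℝ`, species (a)
  have hsu : s = univ := eq_univ_of_not_bddAbove_of_not_bddBelow hsc hab hbb
  obtain ⟨t, hMt⟩ := stub_convexBoundedLine φ u w (fun t ↦ hφ' t (hsu ▸ mem_univ t))
    (fun t ↦ hu' t (hsu ▸ mem_univ t)) (fun t ↦ hwpos t (hsu ▸ mem_univ t)) M
  have := hMφ t (hsu ▸ mem_univ t)
  linarith

/-! ### The crux from its kernel -/

/-- **`ErgoregionBombModT ⇐ ZeroEnergyEscapeCertificate`.**  If every telescope hole carries, on the cage of every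
compact subset of its d.o.c., a zero-energy escape certificate (hypothesis `hZ`, the registered kernel stub
`stub_zeroEnergyEscapeCertificate` of line `SketchIdeator4` verbatim), then the crux
`Theses.ZeroEnergyKerrOrBomb.ErgoregionBombModT` holds — the conclusion below is its body verbatim.  Proof: the crux's
antecedent (a maximal null geodesic with `γ̇ ≠ 0`, `g(γ̇, T) = 0` confined to the cage) is empty by the zero-energy
escape engine `stub_escapeEngine`. -/
theorem ergoregionBombModT_of_zeroEnergyEscapeCertificate
    (hZ : ∀ (𝓑 : Literature.Geometry.Lorentzian.StationaryAFBlackHole.{0}) [𝓑.metric.HasLeviCivita] [Literature.Geometry.Lorentzian.Kerr.Facts], 𝓑.metric.toPseudoRiemannianMetric.IsRicciFlat → 𝓑.IsIPlusRegular → (∀ p : 𝓑.carrier, p ∈ 𝓑.metric.chronologicalFuture 𝓑.timeOrientation 𝓑.Mext) → (∀ p ∈ 𝓑.doc, 𝓑.killing p ≠ 0) → SimplyConnectedSpace 𝓑.doc → ∀ (U : Set 𝓑.carrier) (K : Π x : 𝓑.carrier, TangentSpace (𝓡 4) x), IsOpen U → 𝓑.horizon ⊆ U → IsConnected 𝓑.horizon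 → ContMDiffOn (𝓡 4) ((𝓡 4).prod 𝓘(ℝ, Literature.Geometry.Lorentzian.E4)) ((⊤ : ℕ∞) : WithTop ℕ∞) (fun x ↦ (Bundle.TotalSpace.mk' Literature.Geometry.Lorentzian.E4 x (K x) : TangentBundle (𝓡 4) 𝓑.carrier)) U → (∀ x ∈ U, ∀ v w : TangentSpace (𝓡 4) x, 𝓑.metric.val x (𝓑.metric.leviCivita K x v) w + 𝓑.metric.val x v (𝓑.metric.leviCivita K x w) = 0) → (∀ x ∈ U, VectorField.mlieBracket (𝓡 4) 𝓑.killing K x = 0) → (∀ p ∈ 𝓑.horizon, K p ≠ 0) → (∀ γ : ℝ → 𝓑.carrier, IsMIntegralCurve γ K → γ 0 ∈ 𝓑.horizon → ∀ t, γ t ∈ 𝓑.horizon) → (∀ x ∈ U ∩ 𝓑.doc, 𝓑.metric.val x (K x) (K x) < 0) → (∃ S₀ : Set 𝓑.carrier, IsCompact S₀ ∧ S₀ ⊆ 𝓑.doc ∧ ∀ y ∈ 𝓑.doc, 0 ≤ 𝓑.metric.val y (𝓑.killing y) (𝓑.killing y) → y ∉ U → y ∈ Literature.Geometry.Lorentzian.stationaryOrbit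 𝓑.killing S₀) → ∀ S : Set 𝓑.carrier, IsCompact S → S ⊆ 𝓑.doc → ∃ (W : Set 𝓑.carrier) (F τ : 𝓑.carrier → ℝ) (c C : ℝ), IsOpen W ∧ Literature.Geometry.Lorentzian.stationaryOrbit 𝓑.killing S ⊆ W ∧ 0 < c ∧ ContMDiffOn (𝓡 4) 𝓘(ℝ, ℝ) 2 F W ∧ ContMDiffOn (𝓡 4) 𝓘(ℝ, ℝ) 2 τ W ∧ (∀ σ : ℝ → 𝓑.carrier, IsMIntegralCurve σ 𝓑.killing → σ 0 ∈ W → ∀ t, F (σ t) = F (σ 0) ∧ τ (σ t) = τ (σ 0) + t) ∧ (∀ x ∈ W, ∀ k : TangentSpace (𝓡 4) x, 𝓑.metric.val x k k = 0 → k ≠ 0 → mvfderiv (𝓡 4) τ x k ≠ 0) ∧ ∀ x ∈ Literature.Geometry.Lorentzian.stationaryOrbit 𝓑.killing S, ∀ k : TangentSpace (𝓡 4) x, 𝓑.metric.val x k k = 0 → 𝓑.metric.val x k (𝓑.killing x) = 0 → c * (mvfderiv (𝓡 4) τ x k) ^ 2 ≤ 𝓑.metric.toPseudoRiemannianMetric.hessian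 F x k k ∧ |𝓑.metric.toPseudoRiemannianMetric.hessian τ x k k| ≤ C * (mvfderiv (𝓡 4) τ x k) ^ 2) :
    ∀ (𝓑 : Literature.Geometry.Lorentzian.StationaryAFBlackHole.{0}) [𝓑.metric.HasLeviCivita] [Literature.Geometry.Lorentzian.Kerr.Facts], 𝓑.metric.toPseudoRiemannianMetric.IsRicciFlat → 𝓑.IsIPlusRegular → (∀ p : 𝓑.carrier, p ∈ 𝓑.metric.chronologicalFuture 𝓑.timeOrientation 𝓑.Mext) → (∀ p ∈ 𝓑.doc, 𝓑.killing p ≠ 0) → SimplyConnectedSpace 𝓑.doc → ∀ (U : Set 𝓑.carrier) (K : Π x : 𝓑.carrier, TangentSpace (𝓡 4) x), IsOpen U → 𝓑.horizon ⊆ U → IsConnected 𝓑.horizon → ContMDiffOn (𝓡 4) ((𝓡 4).prod 𝓘(ℝ, Literature.Geometry.Lorentzian.E4)) ((⊤ : ℕ∞) : WithTop ℕ∞) (fun x ↦ (Bundle.TotalSpace.mk' Literature.Geometry.Lorentzian.E4 x (K x) : TangentBundle (𝓡 4) 𝓑.carrier)) U → (∀ x ∈ U, ∀ v w : TangentSpace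 (𝓡 4) x, 𝓑.metric.val x (𝓑.metric.leviCivita K x v) w + 𝓑.metric.val x v (𝓑.metric.leviCivita K x w) = 0) → (∀ x ∈ U, VectorField.mlieBracket (𝓡 4) 𝓑.killing K x = 0) → (∀ p ∈ 𝓑.horizon, K p ≠ 0) → (∀ γ : ℝ → 𝓑.carrier, IsMIntegralCurve γ K → γ 0 ∈ 𝓑.horizon → ∀ t, γ t ∈ 𝓑.horizon) → (∀ x ∈ U ∩ 𝓑.doc, 𝓑.metric.val x (K x) (K x) < 0) → (∃ S₀ : Set 𝓑.carrier, IsCompact S₀ ∧ S₀ ⊆ 𝓑.doc ∧ ∀ y ∈ 𝓑.doc, 0 ≤ 𝓑.metric.val y (𝓑.killing y) (𝓑.killing y) → y ∉ U → y ∈ Literature.Geometry.Lorentzian.stationaryOrbit 𝓑.killing S₀) → ∀ S : Set 𝓑.carrier, IsCompact S → S ⊆ 𝓑.doc → ∀ (γ : ℝ → 𝓑.carrier) (s : Set ℝ), Literature.Geometry.Lorentzian.IsMaximalGeodesicOn 𝓑.metric.toPseudoRiemannianMetric.leviCivita γ s → s.Nonempty → (∀ t ∈ s, 𝓑.metric.val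 (γ t) (Literature.Geometry.Lorentzian.velocity (𝓡 4) γ t) (Literature.Geometry.Lorentzian.velocity (𝓡 4) γ t) = 0 ∧ Literature.Geometry.Lorentzian.velocity (𝓡 4) γ t ≠ 0 ∧ 𝓑.metric.val (γ t) (Literature.Geometry.Lorentzian.velocity (𝓡 4) γ t) (𝓑.killing (γ t)) = 0) → (∀ t ∈ s, γ t ∈ Literature.Geometry.Lorentzian.stationaryOrbit 𝓑.killing S) → ∃ (ν ω : ℝ) (ψ χ : 𝓑.carrier → ℝ), 0 < ν ∧ (∃ U : Set 𝓑.carrier, IsOpen U ∧ 𝓑.doc ∪ 𝓑.horizon ⊆ U ∧ ContMDiffOn (𝓡 4) 𝓘(ℝ, ℝ) ((⊤ : ℕ∞) : WithTop ℕ∞) ψ U ∧ ContMDiffOn (𝓡 4) 𝓘(ℝ, ℝ) ((⊤ : ℕ∞) : WithTop ℕ∞) χ U) ∧ (∀ x ∈ 𝓑.doc, 𝓑.metric.dalembertian ψ x = 0 ∧ 𝓑.metric.dalembertian χ x = 0) ∧ (∀ x ∈ 𝓑.doc, mfderiv (𝓡 4) 𝓘(ℝ, ℝ) ψ x (𝓑.killing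 x) = ν * ψ x - ω * χ x ∧ mfderiv (𝓡 4) 𝓘(ℝ, ℝ) χ x (𝓑.killing x) = ω * ψ x + ν * χ x) ∧ (∃ C : ℝ, ∀ x ∈ 𝓑.doc ∩ 𝓑.metric.chronologicalPast 𝓑.timeOrientation (𝓑.embed '' 𝓑.e.far (𝓑.e.R + 1)), |ψ x| ≤ C ∧ |χ x| ≤ C) ∧ ∃ x ∈ 𝓑.doc, ψ x ≠ 0 ∨ χ x ≠ 0 := by
  intro 𝓑 _ _ h1 h2 h3 h4 h5 U K hU hHU hc hK hKill hbr hK0 htan htl hbelt S hS hSd γ s hγ hs hz hin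
  exfalso
  obtain ⟨W, F, τ, c, C, hW, hSW, hc0, hF, hτ, hinv, hnd, hH⟩ :=
    hZ 𝓑 h1 h2 h3 h4 h5 U K hU hHU hc hK hKill hbr hK0 htan htl hbelt S hS hSd
  exact stub_escapeEngine 𝓑 S W F τ c C hS hW hSW hc0 hF hτ hinv hnd hH γ s hγ hs hz hin

end Summit.FinalStateConjecture.FinalStateConjecture.Theorems.ErgoregionBombModT

end
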